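import Literature.AlgebraicGeometry.HodgeTheory.AlgebraicChartHodgeModel
import Literature.AlgebraicGeometry.HodgeTheory.AnalytificationImmersiveClosedImmersion
import Literature.NumberTheory.Transcendental.AbelianVarietyAnalyticLieGroup
import Literature.Geometry.Kaehler.DeformationEquivalence
import HarnessLib

/-!
# A smooth projective family, analytified: a proper holomorphic submersion whose fibres are the
# algebraic-chart models of the scheme-theoretic fibres

Family `hodge`, layer `Literature/AlgebraicGeometry/Motives`. Theorems only (no definition, no named
fact). Written by the prover seat `hodge-nonav-20241-p1` (g17, cell `hodge-nonav`) as brick F-E of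
prover-Ax's programme «B4 RELATIVE RESIDUES» (route `HodgeConjecture/CyclicUnitaryPowers`; memo
`PROGRAMME-B4-RELATIVE-RESIDUES-Ax-g12`): the repackaging of `HodgeNumberFamilySemicontinuity` §Atlas as
the inputs `hπ`, `hι`, `hdim` of the brick F-C `PeriodsOfRelativeFormsHolomorphic`.

Setting: `f : 𝒳 ⟶ S` over `ℂ`, `S` smooth of relative dimension `m` and separated, `𝒳` smooth of
relative dimension `e` and locally of finite type (for a smooth projective family of relative
dimension `n`, `e = n + m`: `smoothOfRelativeDimension_total`), the complex manifolds `𝒳(ℂ)`, `S(ℂ)`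
charted by the holomorphic ALGEBRAIC charts (`chartedSpaceOfCharts (ComplexPoints.algebraicChart _ _)`,
installed by `letI` in every statement, as in `Motives.surjective_mfderiv_map_algebraicChart`).

* `isProperHolomorphicSubmersion_map_algebraicChart` — for `f` smooth and proper,
  **`f(ℂ) : 𝒳(ℂ) → S(ℂ)` is a proper holomorphic submersion** (`Geometry.Kaehler.IsProperHolomorphicSubmersion`):
  holomorphic by GAGA functoriality (`IsAnalytification.mdifferentiable_comp_map_holds`) and Osgood
  (`contMDiff_omega_of_mdifferentiable`), submersive by SGA1 XII 3.1 (`surjective_mfderiv_map_algebraicChart`),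
  proper by SGA1 XII 3.2 (`AlgPoints.isProperMap_map`).
* `isFibreEmbedding_map_fiberι_comp` — for every Hodge model `B` of the fibre `X_s = fiberOver f s`,
  **`(fiberι f s)(ℂ) ∘ φ_B : X_s^an → 𝒳(ℂ)` identifies `X_s^an` with the fibre `f(ℂ)⁻¹(s)`**
  (`Geometry.Kaehler.IsFibreEmbedding`: holomorphic, a closed embedding, IMMERSIVE — the analytification
  of the closed immersion `X_s ↪ 𝒳`, `IsAnalytification.injective_mfderiv_of_isClosedImmersion`, no
  auxiliary projective compactification of `𝒳` needed — with image the fibre, `AlgPoints.range_map_fiberι`);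
  `contMDiff_real_map_fiberι_comp`, `mfderiv_map_fiberι_comp_tangentJ` — the real `C^∞` and
  `J`-linearity clauses consumed by `le_finrank_hodgePQ_of_fibres`-type statements.
* `isFibreEmbedding_map_fiberι` — the same for the ALGEBRAIC-CHART model `algebraicModel` of the
  fibre (`AlgebraicChartHodgeModel`: carrier `X_s(ℂ)`, structure map `id`), where the embedding is
  `(fiberι f s)(ℂ)` on the nose. `algebraicModel` is a plain `def`, so its charts are installed at the
  model type `Fin n → ℂ` by `letI : ChartedSpace (Fin n → ℂ) (ComplexPoints (fiberOver f s)) :=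
  (algebraicModel hX_s).chartedSpace` (consumers do the same, or pass the instance explicitly);
  `isManifold_fibre_algebraicModel`; `finrank_fibre_add_base` — `dim ℂⁿ + dim ℂᵐ = dim ℂⁿ⁺ᵐ` (`hdim`).

Honest scope: packaging; nothing here says HC or any rung is proved.

## References

* [SerreGAGA1956] J.-P. Serre, GAGA, Ann. Inst. Fourier 6 (1956), §2 n°5–6.
* [SGA1] A. Grothendieck, M. Raynaud, SGA 1, Exp. XII Prop. 3.1 (iv), Prop. 3.2 (v).
* [VoisinHodgeI2002] C. Voisin, Hodge Theory and Complex Algebraic Geometry I (2002), §9.1 Def. 9.2,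
  §9.3.
* [Kodaira2005] K. Kodaira, Complex Manifolds and Deformation of Complex Structures (2005), §2.3
  Def. 2.8.
-/

noncomputable section

open scoped Manifold ContDiff Topology
open CategoryTheory AlgebraicGeometry Set Function Module
open Literature.NumberTheory.Transcendental Literature.Geometry.Kaehler
open Literature.AlgebraicGeometry.HodgeTheory

namespace Literature.AlgebraicGeometry.Motives

section Family

variable {𝒳 S : SchemeOver ℂ} (f : 𝒳 ⟶ S) {n m e : ℕ}

/-- The total space of a smooth projective family of relative dimension `n` over a base smooth of
relative dimension `m` is smooth of relative dimension `n + m` over `ℂ`. [cite: SGA1, Exp. II] -/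
theorem smoothOfRelativeDimension_total [SmoothOfRelativeDimension m S.hom]
    (hf : IsSmoothProjectiveFamily f n) : SmoothOfRelativeDimension (n + m) 𝒳.hom := by
  haveI : SmoothOfRelativeDimension n f.left := hf.smoothOfRelativeDimension
  rw [← Over.w f]
  infer_instance

/-- The total space of a proper family over a separated base is separated over `ℂ` (private
plumbing). [folklore] -/
private theorem isSeparated_total [IsSeparated S.hom] [IsProper f.left] : IsSeparated 𝒳.hom := by
  rw [← Over.w f]
  infer_instance

/-- `dim_ℂ ℂⁿ + dim_ℂ ℂᵐ = dim_ℂ ℂⁿ⁺ᵐ` — the hypothesis `hdim` of the period bricks for the model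
spaces of fibre, base and total space (Kodaira Def. 2.8 (iii): the rank of the Jacobian of `ϖ` is
`dim B`, the fibres have dimension `dim ℳ - dim B`). [cite: Kodaira2005, §2.3 Def. 2.8 (iii)] -/
theorem finrank_fibre_add_base (n m : ℕ) :
    finrank ℂ (Fin n → ℂ) + finrank ℂ (Fin m → ℂ) = finrank ℂ (Fin (n + m) → ℂ) := by
  simp only [finrank_fin_fun]

/-! ### `f(ℂ)` is a proper holomorphic submersion -/

/-- **`f(ℂ) : 𝒳(ℂ) → S(ℂ)` is a proper holomorphic submersion** for `f` smooth and proper between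
smooth `ℂ`-schemes locally of finite type, in the atlases of holomorphic algebraic charts (Voisin I
Def. 9.2 / Kodaira Def. 2.8 for the analytification of a smooth proper morphism: holomorphic by GAGA
functoriality and Osgood, submersive by SGA1 XII Prop. 3.1 (iv), proper by SGA1 XII Prop. 3.2 (v)).
[cite: SGA1, Exp. XII Prop. 3.1 (iv) and Prop. 3.2 (v)] [cite: VoisinHodgeI2002, §9.1 Def. 9.2] -/
theorem isProperHolomorphicSubmersion_map_algebraicChart [LocallyOfFiniteType 𝒳.hom]
    [SmoothOfRelativeDimension e 𝒳.hom] [LocallyOfFiniteType S.hom] [SmoothOfRelativeDimension m S.hom]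
    [Smooth f.left] [IsProper f.left] :
    letI := chartedSpaceOfCharts (ComplexPoints.algebraicChart 𝒳 e)
      (ComplexPoints.mem_algebraicChart_source 𝒳 e)
    letI := chartedSpaceOfCharts (ComplexPoints.algebraicChart S m)
      (ComplexPoints.mem_algebraicChart_source S m)
    IsProperHolomorphicSubmersion (Fin e → ℂ) (Fin m → ℂ)
      (AlgPoints.map f : ComplexPoints 𝒳 → ComplexPoints S) := by
  letI csT := chartedSpaceOfCharts (ComplexPoints.algebraicChart 𝒳 e)
    (ComplexPoints.mem_algebraicChart_source 𝒳 e)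
  letI csB := chartedSpaceOfCharts (ComplexPoints.algebraicChart S m)
    (ComplexPoints.mem_algebraicChart_source S m)
  haveI : IsManifold 𝓘(ℂ, Fin e → ℂ) ω (ComplexPoints 𝒳) := isManifold_algebraicChart 𝒳 e
  haveI : IsManifold 𝓘(ℂ, Fin m → ℂ) ω (ComplexPoints S) := isManifold_algebraicChart S m
  have hφT : IsAnalytification (Fin e → ℂ) 𝒳 e (id : ComplexPoints 𝒳 → _) :=
    isAnalytification_algebraicChart 𝒳 e
  have hφB : IsAnalytification (Fin m → ℂ) S m (id : ComplexPoints S → _) :=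
    isAnalytification_algebraicChart S m
  have hhol : MDifferentiable 𝓘(ℂ, Fin e → ℂ) 𝓘(ℂ, Fin m → ℂ)
      (AlgPoints.map f : ComplexPoints 𝒳 → ComplexPoints S) :=
    IsAnalytification.mdifferentiable_comp_map_holds hφT hφB f (AlgPoints.map f) rfl
  exact
    { contMDiff := contMDiff_omega_of_mdifferentiable hhol
      surjective_mfderiv := fun x ↦ surjective_mfderiv_map_algebraicChart (e := e) (e' := m) f x
      isProperMap := AlgPoints.isProperMap_map f }

/-! ### The fibre embeddings -/

section Fibre

variable [LocallyOfFiniteType 𝒳.hom] [SmoothOfRelativeDimension e 𝒳.hom] [IsSeparated S.hom]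
  [IsProper f.left]

/-- **The fibre embedding of a Hodge model of `X_s`**: for `B` a Hodge model of the fibre
`X_s = fiberOver f s` of the proper `f : 𝒳 ⟶ S` (`S` separated, `𝒳` smooth, `X_s` smooth projective of
dimension `n`), the map `ψ_B = (fiberι f s)(ℂ) ∘ φ_B : X_s^an → 𝒳(ℂ)` is an `IsFibreEmbedding` over
`s` for `f(ℂ)` and the algebraic charts of `𝒳(ℂ)`: holomorphic (GAGA functoriality + Osgood), a closed
embedding (continuous injective from the compact `X_s^an` to the Hausdorff `𝒳(ℂ)`), immersive (the
analytification of the closed immersion `X_s ↪ 𝒳`, GAGA §2 n°6: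
`IsAnalytification.injective_mfderiv_of_isClosedImmersion`), with image the fibre `f(ℂ)⁻¹(s)`
(`AlgPoints.range_map_fiberι`). [cite: SerreGAGA1956, §2 n°5 Prop. 2 and n°6 Prop. 3 Cor. 2]
[cite: Kodaira2005, §2.3 Def. 2.8 (i)–(ii)] -/
theorem isFibreEmbedding_map_fiberι_comp (s : ComplexPoints S)
    (hXs : IsSmoothProjective n (fiberOver f s)) (B : HodgeModel n (fiberOver f s)) :
    letI := chartedSpaceOfCharts (ComplexPoints.algebraicChart 𝒳 e)
      (ComplexPoints.mem_algebraicChart_source 𝒳 e)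
    IsFibreEmbedding B.model (Fin e → ℂ) (AlgPoints.map f : ComplexPoints 𝒳 → ComplexPoints S) s
      (fun a ↦ AlgPoints.map (fiberι f s) (B.toComplexPoints a)) := by
  letI csT := chartedSpaceOfCharts (ComplexPoints.algebraicChart 𝒳 e)
    (ComplexPoints.mem_algebraicChart_source 𝒳 e)
  haveI : IsManifold 𝓘(ℂ, Fin e → ℂ) ω (ComplexPoints 𝒳) := isManifold_algebraicChart 𝒳 e
  haveI : IsSeparated 𝒳.hom := isSeparated_total f
  haveI : T2Space (ComplexPoints 𝒳) := ComplexPoints.t2Space_of_isSeparated 𝒳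
  haveI : SmoothOfRelativeDimension n (fiberOver f s).hom := hXs.smoothOfRelativeDimension
  haveI : Smooth (fiberOver f s).hom := SmoothOfRelativeDimension.smooth n _
  haveI : LocallyOfFiniteType (fiberOver f s).hom := inferInstance
  haveI : CompactSpace B.carrier := by
    haveI := ComplexPoints.compactSpace_of_isSmoothProjective hXs
    exact B.isAnalytification.homeomorph.symm.compactSpace
  have hφT : IsAnalytification (Fin e → ℂ) 𝒳 e (id : ComplexPoints 𝒳 → _) :=
    isAnalytification_algebraicChart 𝒳 e
  set ψ : B.carrier → ComplexPoints 𝒳 := fun a ↦ AlgPoints.map (fiberι f s) (B.toComplexPoints a)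
    with hψdef
  have hcomm : id ∘ ψ = AlgPoints.map (fiberι f s) ∘ B.toComplexPoints := rfl
  have hhol : MDifferentiable 𝓘(ℂ, B.model) 𝓘(ℂ, Fin e → ℂ) ψ :=
    IsAnalytification.mdifferentiable_comp_map_holds B.isAnalytification hφT (fiberι f s) ψ hcomm
  haveI : IsClosedImmersion (fiberι f s).left := by
    rw [fiberι_left]
    exact MorphismProperty.pullback_fst (P := @IsClosedImmersion) f.left s.left
      (isClosedImmersion_left_of_algPoints s)
  refine
    { contMDiff := contMDiff_omega_of_mdifferentiable hhol
      isClosedEmbedding := hhol.continuous.isClosedEmbedding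
        ((AlgPoints.map_fiberι_injective f s).comp B.isAnalytification.isHomeomorph.injective)
      injective_mfderiv := fun x ↦
        B.isAnalytification.injective_mfderiv_of_isClosedImmersion hφT (fiberι f s) ψ hcomm x
      range_eq := ?_ }
  change range ((AlgPoints.map (fiberι f s) : ComplexPoints (fiberOver f s) → ComplexPoints 𝒳) ∘
    B.toComplexPoints) = _
  rw [Set.range_comp (AlgPoints.map (fiberι f s)) B.toComplexPoints,
    B.isAnalytification.isHomeomorph.surjective.range_eq, Set.image_univ, AlgPoints.range_map_fiberι]

/-- The fibre embedding `ψ_B = (fiberι f s)(ℂ) ∘ φ_B` is real `C^∞` (it is holomorphic).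
[cite: SerreGAGA1956, §2 n°5 Prop. 2] -/
theorem contMDiff_real_map_fiberι_comp (s : ComplexPoints S)
    (hXs : IsSmoothProjective n (fiberOver f s)) (B : HodgeModel n (fiberOver f s)) :
    letI := chartedSpaceOfCharts (ComplexPoints.algebraicChart 𝒳 e)
      (ComplexPoints.mem_algebraicChart_source 𝒳 e)
    ContMDiff 𝓘(ℝ, B.model) 𝓘(ℝ, Fin e → ℂ) ∞
      (fun a ↦ AlgPoints.map (fiberι f s) (B.toComplexPoints a)) := by
  letI csT := chartedSpaceOfCharts (ComplexPoints.algebraicChart 𝒳 e)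
    (ComplexPoints.mem_algebraicChart_source 𝒳 e)
  haveI : IsManifold 𝓘(ℂ, Fin e → ℂ) ω (ComplexPoints 𝒳) := isManifold_algebraicChart 𝒳 e
  exact (isFibreEmbedding_map_fiberι_comp f s hXs B).contMDiff.mdifferentiable (by decide)
    |>.contMDiff_real_of_complex

/-- The real differential of the fibre embedding commutes with `J` (it is `ℂ`-linear).
[cite: VoisinHodgeI2002, §2.2.1] -/
theorem mfderiv_map_fiberι_comp_tangentJ (s : ComplexPoints S)
    (hXs : IsSmoothProjective n (fiberOver f s)) (B : HodgeModel n (fiberOver f s))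
    (x : B.carrier) (v : TangentSpace 𝓘(ℝ, B.model) x) :
    letI := chartedSpaceOfCharts (ComplexPoints.algebraicChart 𝒳 e)
      (ComplexPoints.mem_algebraicChart_source 𝒳 e)
    mfderiv 𝓘(ℝ, B.model) 𝓘(ℝ, Fin e → ℂ)
        (fun a ↦ AlgPoints.map (fiberι f s) (B.toComplexPoints a)) x (tangentJ B.model x v) =
      tangentJ (Fin e → ℂ) (AlgPoints.map (fiberι f s) (B.toComplexPoints x))
        (mfderiv 𝓘(ℝ, B.model) 𝓘(ℝ, Fin e → ℂ)
          (fun a ↦ AlgPoints.map (fiberι f s) (B.toComplexPoints a)) x v) := by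
  letI csT := chartedSpaceOfCharts (ComplexPoints.algebraicChart 𝒳 e)
    (ComplexPoints.mem_algebraicChart_source 𝒳 e)
  haveI : IsManifold 𝓘(ℂ, Fin e → ℂ) ω (ComplexPoints 𝒳) := isManifold_algebraicChart 𝒳 e
  exact mfderiv_real_tangentJ
    ((isFibreEmbedding_map_fiberι_comp f s hXs B).contMDiff.mdifferentiable (by decide) x) v

/-- **The fibre embedding of the ALGEBRAIC-CHART model is `(fiberι f s)(ℂ)` itself**: for the model
`algebraicModel hX_s` of the fibre (carrier `X_s(ℂ)` with the algebraic charts — installed here as the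
`letI` instance `(algebraicModel hX_s).chartedSpace` at the model type `Fin n → ℂ` — structure map `id`),
`(fiberι f s)(ℂ) : X_s(ℂ) → 𝒳(ℂ)` is an `IsFibreEmbedding` over `s` — the hypothesis `hι` (with
`O = univ`) of the relative period bricks. [cite: SerreGAGA1956, §2 n°5 Prop. 2 and n°6 Prop. 3 Cor. 2]
[cite: Kodaira2005, §2.3 Def. 2.8 (i)–(ii)] -/
theorem isFibreEmbedding_map_fiberι (s : ComplexPoints S) (hXs : IsSmoothProjective n (fiberOver f s)) :
    letI := chartedSpaceOfCharts (ComplexPoints.algebraicChart 𝒳 e)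
      (ComplexPoints.mem_algebraicChart_source 𝒳 e)
    letI : ChartedSpace (Fin n → ℂ) (ComplexPoints (fiberOver f s)) := (algebraicModel hXs).chartedSpace
    IsFibreEmbedding (Fin n → ℂ) (Fin e → ℂ) (AlgPoints.map f : ComplexPoints 𝒳 → ComplexPoints S) s
      (AlgPoints.map (fiberι f s) : ComplexPoints (fiberOver f s) → ComplexPoints 𝒳) :=
  isFibreEmbedding_map_fiberι_comp f s hXs (algebraicModel hXs)

omit [LocallyOfFiniteType 𝒳.hom] [IsSeparated S.hom] [IsProper f.left] in
/-- The algebraic-chart carrier `X_s(ℂ)` of the fibre is a complex manifold (holomorphic atlas), for the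
`letI` instance `(algebraicModel hX_s).chartedSpace` read at the model type `Fin n → ℂ`.
[cite: SerreGAGA1956, §2 n°5 Prop. 2] -/
theorem isManifold_fibre_algebraicModel (s : ComplexPoints S) (hXs : IsSmoothProjective n (fiberOver f s)) :
    letI : ChartedSpace (Fin n → ℂ) (ComplexPoints (fiberOver f s)) := (algebraicModel hXs).chartedSpace
    IsManifold 𝓘(ℂ, Fin n → ℂ) ω (ComplexPoints (fiberOver f s)) :=
  (algebraicModel hXs).isManifold

end Fibre

/-! ### Smooth projective families: the hypotheses `hπ`, `hι` at once -/

/-- **For a smooth projective family `f : 𝒳 ⟶ S` of relative dimension `n` over `S` smooth of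
relative dimension `m` and separated: `f(ℂ)` is a proper holomorphic submersion for the algebraic
charts of `𝒳(ℂ)` (model `ℂⁿ⁺ᵐ`) and `S(ℂ)` (model `ℂᵐ`), and every fibre `X_s(ℂ)` with its algebraic
charts (the model `algebraicModel`) is embedded as the fibre over `s` by `(fiberι f s)(ℂ)`.**
[cite: VoisinHodgeI2002, §9.1 Def. 9.2] [cite: SGA1, Exp. XII Prop. 3.1 (iv) and Prop. 3.2 (v)] -/
theorem isProperHolomorphicSubmersion_and_isFibreEmbedding_of_isSmoothProjectiveFamily
    [SmoothOfRelativeDimension m S.hom] [IsSeparated S.hom] (hf : IsSmoothProjectiveFamily f n) :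
    letI := smoothOfRelativeDimension_total (m := m) f hf
    letI : Smooth 𝒳.hom := SmoothOfRelativeDimension.smooth (n + m) _
    letI : LocallyOfFiniteType 𝒳.hom := inferInstance
    letI : Smooth S.hom := SmoothOfRelativeDimension.smooth m _
    letI : LocallyOfFiniteType S.hom := inferInstance
    letI := chartedSpaceOfCharts (ComplexPoints.algebraicChart 𝒳 (n + m))
      (ComplexPoints.mem_algebraicChart_source 𝒳 (n + m))
    letI := chartedSpaceOfCharts (ComplexPoints.algebraicChart S m)
      (ComplexPoints.mem_algebraicChart_source S m)
    IsProperHolomorphicSubmersion (Fin (n + m) → ℂ) (Fin m → ℂ)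
        (AlgPoints.map f : ComplexPoints 𝒳 → ComplexPoints S) ∧
      ∀ s : ComplexPoints S,
        letI : ChartedSpace (Fin n → ℂ) (ComplexPoints (fiberOver f s)) :=
          (algebraicModel (hf.isSmoothProjective s)).chartedSpace
        IsFibreEmbedding (Fin n → ℂ) (Fin (n + m) → ℂ)
          (AlgPoints.map f : ComplexPoints 𝒳 → ComplexPoints S) s
          (AlgPoints.map (fiberι f s) : ComplexPoints (fiberOver f s) → ComplexPoints 𝒳) := by
  haveI := smoothOfRelativeDimension_total (m := m) f hf
  haveI : Smooth 𝒳.hom := SmoothOfRelativeDimension.smooth (n + m) _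
  haveI : LocallyOfFiniteType 𝒳.hom := inferInstance
  haveI : Smooth S.hom := SmoothOfRelativeDimension.smooth m _
  haveI : LocallyOfFiniteType S.hom := inferInstance
  haveI : Smooth f.left := hf.smooth
  haveI : IsProper f.left := hf.isProper
  exact ⟨isProperHolomorphicSubmersion_map_algebraicChart f,
    fun s ↦ isFibreEmbedding_map_fiberι f s (hf.isSmoothProjective s)⟩

end Family

end Literature.AlgebraicGeometry.Motives

end
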